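import Summits.NavierStokesRegularity.OSWSelfSimilar.SheetREvansEnclosure
import Summits.NavierStokesRegularity.OSWSelfSimilar.SheetREvansTaylorModel
import HarnessLib

/-!
# SHEET-ℝ frame, Z3-SR-SPEC S2(a): the FAR-FIELD EXCLUSION for the odd-class Evans function from the order-3 expansion and four literals —
# `‖θ‖·(|⟪h,a₀⟫|/R + |⟪h,a₁⟫|/R² + (|⟪h,a₂⟫| + ‖h‖‖a₃‖/c₀)/R³) < 1 ⇒ E(σ) ≠ 0` for `‖σ‖ ≥ R`, `m + Re σ ≥ c₀`

HONEST FRAMING (cell ns-blowup GROUP B / zone Z3, case Z3-SR-SPEC, step (S2)(a) «FAR FIELD: `k(σ) = θ[‖h‖²_w σ⁻¹ − ⟨h, wa₁⟩σ⁻² + ⟨h, wa₂⟩σ⁻³]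
− θσ⁻³⟨h, w𝒜(σ)⁻¹Ja₃⟩ … ⇒ |k| < 1 for |σ| ≥ R₀`»; 1-D MODEL certificate frame; not Euler/NS; «violates: none — MODEL»). Nothing here is interval
arithmetic: the chain `a₀ = f, a_{j+1} = A a_j` is encoded resolvent-only (`a_j = R_K(z)(a_{j+1} + z a_j)`, cert-5's `PseudoResolventFarField`), and
the ONE numeric hypothesis `hB` is the far-field row's inequality with its literals; the (S1) datum `h` is a HYPOTHESIS.  This file discharges the
far-field hypothesis `hfar` of `SheetRSpectrumOddAssembly.weakEigen_iff_eq_one` for functionals of inner-product form `ℓ = ⟪h, ·⟫`: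

* `norm_sum_range_three_le` — bookkeeping of the three leading terms;
* **`norm_k_le_of_farField`** — `‖θ·⟪h, R_K(σ)f⟫‖ ≤ ‖θ‖·(|⟪h,a₀⟫|/R + |⟪h,a₁⟫|/R² + (|⟪h,a₂⟫| + ‖h‖‖a₃‖/c₀)/R³)` for `‖σ‖ ≥ R > 0`,
  `0 < c₀ ≤ m + Re σ` (from `SheetREvansTaylorModel.evans_farField_remainderC`, n = 3);
* **`evansOdd_ne_zero_of_farField`** — hence `E(σ) = evansOdd hL K h (⟪h,·⟫ ∘ subtype) f θ σ ≠ 0` whenever the bracket is `< 1`.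
Pure functional analysis + arithmetic; no definition, no named fact.  WHAT THIS IS NOT: not NS; not the certificate; no number of record moves.
-/

noncomputable section

namespace Summit.NavierStokesRegularity.OSWSelfSimilar
namespace SheetREvansFarField

open _root_.MeasureTheory _root_.Set _root_.Filter _root_.Real SheetRWeakProfilePV SheetRWeakToStrong SheetREnergyClass SheetRWeightedMeasure
  SheetRLinearisedTests SheetREnergySpace SheetRTestSpace SheetRLinearisedFormBounds SheetRSolutionOperator SheetRLinearisedCutoffEnergy
  SheetRResolventPair SheetRComplexPivot SheetRResolventComplex SheetRResolventIdentity SheetRPerturbedUniqueness SheetRPerturbedPair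
  SheetRPerturbedResolventC SheetRPerturbedResolventIdentityC SheetROddClass SheetRResolventOddClass SheetRGeneratorOddWeak SheetREvansOdd
  SheetREvansEnclosure SheetREvansTaylorModel Literature.Analysis.OperatorTheory
open scoped Topology ENNReal InnerProductSpace

variable {L D₀ D₁ V₀ c m : ℝ} {d V : ℝ → ℝ}

/-- Bookkeeping: the three leading far-field terms are bounded by `|⟪h,a₀⟫|/R + |⟪h,a₁⟫|/R² + |⟪h,a₂⟫|/R³` once `‖σ‖ ≥ R > 0`. [folklore] -/
theorem norm_sum_range_three_le {σ : ℂ} {R : ℝ} (hR : 0 < R) (hRσ : R ≤ ‖σ‖) (b : ℕ → ℂ) :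
    ‖∑ j ∈ Finset.range 3, ((-1 : ℂ) ^ j * σ⁻¹ ^ (j + 1)) * b j‖ ≤ ‖b 0‖ / R + ‖b 1‖ / R ^ 2 + ‖b 2‖ / R ^ 3 := by
  have hσ0 : 0 < ‖σ‖ := lt_of_lt_of_le hR hRσ
  have hinv : ‖σ‖⁻¹ ≤ R⁻¹ := by rw [inv_le_inv₀ hσ0 hR]; exact hRσ
  have hinv0 : 0 ≤ ‖σ‖⁻¹ := inv_nonneg.2 hσ0.le
  have hterm : ∀ j : ℕ, ‖((-1 : ℂ) ^ j * σ⁻¹ ^ (j + 1)) * b j‖ ≤ ‖b j‖ / R ^ (j + 1) := by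
    intro j
    rw [norm_mul, norm_mul, norm_pow, norm_neg, norm_one, one_pow, one_mul, norm_pow, norm_inv, div_eq_mul_inv, mul_comm]
    refine mul_le_mul_of_nonneg_left ?_ (norm_nonneg _)
    rw [← inv_pow]
    exact pow_le_pow_left₀ hinv0 hinv _
  calc ‖∑ j ∈ Finset.range 3, ((-1 : ℂ) ^ j * σ⁻¹ ^ (j + 1)) * b j‖
      ≤ ∑ j ∈ Finset.range 3, ‖((-1 : ℂ) ^ j * σ⁻¹ ^ (j + 1)) * b j‖ := norm_sum_le _ _
    _ ≤ ∑ j ∈ Finset.range 3, ‖b j‖ / R ^ (j + 1) := Finset.sum_le_sum fun j _ => hterm j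
    _ = ‖b 0‖ / R + ‖b 1‖ / R ^ 2 + ‖b 2‖ / R ^ 3 := by
        simp only [Finset.sum_range_succ, Finset.sum_range_zero, zero_add, pow_one]

/-- **The far-field bound of `k(σ) = θ⟪h, R_K(σ)f⟫`.**  With the resolvent-only chain `a₀ = f`, `a_j = R_K(z)(a_{j+1} + z a_j)` (`j < 3`),
for `‖σ‖ ≥ R > 0` and `0 < c₀ ≤ m + Re σ`:
`‖θ⟪h, R_K(σ)f⟫‖ ≤ ‖θ‖·(‖⟪h,a₀⟫‖/R + ‖⟪h,a₁⟫‖/R² + (‖⟪h,a₂⟫‖ + ‖h‖‖a₃‖/c₀)/R³)`. [folklore] -/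
theorem norm_k_le_of_farField (hL : 0 < L) (K : Esp L hL →L[ℝ] W L) (h : GardingDataKC L hL d V K D₀ D₁ V₀ c m) {z : ℂ} (hz : -m < z.re)
    (hv : Wc L) (θ : ℂ) {a : ℕ → Wc L} (hchain : ∀ j < 3, a j = resolventKC hL K h z (a (j + 1) + z • a j))
    {c₀ R : ℝ} (hc₀ : 0 < c₀) (hR : 0 < R) {σ : ℂ} (hσ : -m < σ.re) (hc₀σ : c₀ ≤ m + σ.re) (hRσ : R ≤ ‖σ‖) :
    ‖θ * ⟪hv, resolventKC hL K h σ (a 0)⟫_ℂ‖ ≤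
      ‖θ‖ * (‖⟪hv, a 0⟫_ℂ‖ / R + ‖⟪hv, a 1⟫_ℂ‖ / R ^ 2 + (‖⟪hv, a 2⟫_ℂ‖ + ‖hv‖ * ‖a 3‖ / c₀) / R ^ 3) := by
  have hσ0 : 0 < ‖σ‖ := lt_of_lt_of_le hR hRσ
  have hσne : σ ≠ 0 := fun h0 => by rw [h0, norm_zero] at hσ0; exact lt_irrefl _ hσ0
  have hrem := evans_farField_remainderC hL K h hz hσ hσne hchain hv
  have hsum := norm_sum_range_three_le hR hRσ (fun j => ⟪hv, a j⟫_ℂ)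
  -- the remainder: `‖σ‖⁻¹^3 ‖h‖ ‖a₃‖/(m + Re σ) ≤ ‖h‖‖a₃‖/(c₀ R³)`
  have hinv : ‖σ‖⁻¹ ≤ R⁻¹ := by rw [inv_le_inv₀ hσ0 hR]; exact hRσ
  have hinv3 : ‖σ‖⁻¹ ^ 3 ≤ (R ^ 3)⁻¹ := by rw [← inv_pow]; exact pow_le_pow_left₀ (inv_nonneg.2 hσ0.le) hinv 3
  have hmσ : 0 < m + σ.re := lt_of_lt_of_le hc₀ hc₀σ
  have hrem' : ‖σ‖⁻¹ ^ 3 * ‖hv‖ * ‖a 3‖ / (m + σ.re) ≤ ‖hv‖ * ‖a 3‖ / c₀ / R ^ 3 := by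
    rw [div_le_iff₀ hmσ]
    have hR3 : 0 < R ^ 3 := by positivity
    calc ‖σ‖⁻¹ ^ 3 * ‖hv‖ * ‖a 3‖ ≤ (R ^ 3)⁻¹ * ‖hv‖ * ‖a 3‖ := by gcongr
      _ = ‖hv‖ * ‖a 3‖ / c₀ / R ^ 3 * c₀ := by field_simp
      _ ≤ ‖hv‖ * ‖a 3‖ / c₀ / R ^ 3 * (m + σ.re) := by gcongr
  have htri : ‖⟪hv, resolventKC hL K h σ (a 0)⟫_ℂ‖ ≤
      ‖⟪hv, a 0⟫_ℂ‖ / R + ‖⟪hv, a 1⟫_ℂ‖ / R ^ 2 + (‖⟪hv, a 2⟫_ℂ‖ + ‖hv‖ * ‖a 3‖ / c₀) / R ^ 3 := by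
    have := norm_le_norm_add_norm_sub' (⟪hv, resolventKC hL K h σ (a 0)⟫_ℂ)
      (∑ j ∈ Finset.range 3, ((-1 : ℂ) ^ j * σ⁻¹ ^ (j + 1)) * ⟪hv, a j⟫_ℂ)
    have e : (‖⟪hv, a 2⟫_ℂ‖ + ‖hv‖ * ‖a 3‖ / c₀) / R ^ 3 = ‖⟪hv, a 2⟫_ℂ‖ / R ^ 3 + ‖hv‖ * ‖a 3‖ / c₀ / R ^ 3 := by ring
    rw [e]
    linarith [hrem.trans hrem']
  rw [norm_mul]
  exact mul_le_mul_of_nonneg_left htri (norm_nonneg θ)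

/-- **THE FAR-FIELD EXCLUSION**: under the chain hypothesis and the ONE inequality
`‖θ‖·(‖⟪h,a₀⟫‖/R + ‖⟪h,a₁⟫‖/R² + (‖⟪h,a₂⟫‖ + ‖h‖‖a₃‖/c₀)/R³) < 1`, the odd-class Evans function with `ℓ = ⟪h, ·⟫` does not vanish at any `σ`
with `Re σ > −m`, `m + Re σ ≥ c₀`, `‖σ‖ ≥ R` — the shape of the hypothesis `hfar` of `SheetRSpectrumOddAssembly` (there: `c₀ = m − 3/100`,
`R = 1141/100`). [folklore] -/
theorem evansOdd_ne_zero_of_farField (hL : 0 < L) (K : Esp L hL →L[ℝ] W L) (h : GardingDataKC L hL d V K D₀ D₁ V₀ c m) {z : ℂ}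
    (hz : -m < z.re) (hv : Wc L) (f : Wcodd L) (θ : ℂ) {a : ℕ → Wc L} (ha0 : a 0 = (f : Wc L))
    (hchain : ∀ j < 3, a j = resolventKC hL K h z (a (j + 1) + z • a j))
    {c₀ R : ℝ} (hc₀ : 0 < c₀) (hR : 0 < R)
    (hB : ‖θ‖ * (‖⟪hv, a 0⟫_ℂ‖ / R + ‖⟪hv, a 1⟫_ℂ‖ / R ^ 2 + (‖⟪hv, a 2⟫_ℂ‖ + ‖hv‖ * ‖a 3‖ / c₀) / R ^ 3) < 1)
    {σ : ℂ} (hσ : -m < σ.re) (hc₀σ : c₀ ≤ m + σ.re) (hRσ : R ≤ ‖σ‖) :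
    evansOdd hL K h ((innerSL ℂ hv).comp (Wcodd L).subtypeL) f θ σ ≠ 0 := by
  have hk := norm_k_le_of_farField hL K h hz hv θ hchain hc₀ hR hσ hc₀σ hRσ
  intro hE
  rw [evansOdd, ContinuousLinearMap.comp_apply, Submodule.subtypeL_apply, coe_resolventOdd, innerSL_apply_apply, ← ha0, sub_eq_zero] at hE
  have h1 : ‖θ * ⟪hv, resolventKC hL K h σ (a 0)⟫_ℂ‖ = 1 := by rw [← hE, norm_one]
  linarith

end SheetREvansFarField
end Summit.NavierStokesRegularity.OSWSelfSimilar

end
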